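import Summits.CriticalPhenomena.PercolationContinuityZ3.Theorems.PercNearOneGluingNoHeavyConstsFourPointSplit
import Mathlib.Tactic.LinearCombination
import HarnessLib

/-!
# The summed three-point lattice inequality SK3 (conjecture) and its exact propagation through terminal 2-sums (kernel)

builds on p205010 (kernel theorem, internal audit signed; external expert review pending)

Lane `prim/consts`, seat prim-consts-1 gen 13 (memo `FROM-prim-consts-1-g13-SKELETON.md` §8), support file for the crux `NoHeavyLowerTail`
(stmt-CriticalPhenomena-4575; `--supports`): ONE `Prop` definition (an OPEN statement, tagged `@[conjecture]`) and one theorem; no sorries; standard axioms.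
Nothing here claims the conjecture.

For three vertices `u, v, x` write `s = μ(u|v|x)`, `j_u = μ(u ↮ v, u ↮ x, v ⟷ x)` (`u` alone), `j_v`, `j_x`, `k = μ(u ⟷ v ⟷ x)`.
* `Consts.ThreePointSK` — **SK3** (typed here as a conjecture, gen 13; **PROVED in gen 14: `Consts.threePointSK_holds` in
  `…ConstsThreePointSKProof`, by concavity of the margin along every edge weight**): `j_u j_v + j_u j_x + j_v j_x ≤ s · k` on every finite
  weighted graph.  **LITERATURE (recorded gen 15): this is a PUBLISHED theorem — N. Gladkov, *A strong FKG inequality for multiple events*,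
  Bull. Lond. Math. Soc. 56 (2024), Cor. 4.2 (doi:10.1112/blms.13101 = arXiv:2305.02653 Cor. 3.6; "first conjectured in an unpublished work of
  Erik Aas", Gladkov–Zimin arXiv:2404.08873 §5, where it is also LP-certified), a corollary of his 'sunflower' strong Harris–Kleitman inequality
  `μ(A)μ(B) ≥ e₂(μ(C₁),…,μ(C_k))`; it is ALREADY IN THE TREE as `Literature.Probability.Percolation.prodBernoulli_threePoint_strongHarris`
  (`Literature/Probability/Percolation/StrongHarrisThreePoint.lean`, any finite vertex type, cells written as `{a↔b} ∩ {a↔c}ᶜ` etc., which are the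
  same events).  So SK3 has two independent kernel proofs (Gladkov's induction via `prodBernoulli_strongHarris`, and gen 14's edge-concavity); the
  attribution "conjectured in this programme" below is superseded.**  KERNEL part already here:
  `j_u (j_v + j_x) ≤ s k` for each `u` (Ahlswede–Daykin, `Consts.real_alone_mul_alone_union_le` in `…ConstsThreePointLattice`), hence `Σ ≤ (3/2) s k`;
  the summed form is NOT an AD instance (the diagonal pairs force positive diagonal weights).  Evidence (float, exact enumeration per weighting,
  `prim-consts-1/g13/eng/law_ineq_probe.py`, `sk_probe2.py`): 4 000 random weighted graphs on ≤ 7 vertices with corner-biased weights: NO violation, maximum of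
  `Σ − s k` equal to `0` up to rounding, attained exactly on the PATH FAMILIES (`j_v = 0 ⇒ s k = j_u j_x`), which are the faces where the composition of
  `…ConstsTwoSumPoly` needs input beyond Harris/TS/DUU (memo §3(a)); with SK3 added to the piece constraints the DUU of a terminal 2-sum at its private root
  stops failing numerically (memo §8).
* `Consts.TwoSum.poly_SK3` — **KERNEL**: SK3 is EXACTLY PRESERVED by 2-sums through a terminal: with the composite pattern law of `…ConstsTwoSumPoly`,
  `SK3(2-sum) = α₁·SK3(piece 2) + α₂·SK3(piece 1) + (eight nonnegative monomials)` — a 10-term certificate (kit j169181) checked by `linear_combination`.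
  So SK3 holds on every iterated terminal 2-sum of pieces on which it holds.
References: N. Gladkov, Bull. Lond. Math. Soc. 56 (2024), doi:10.1112/blms.13101 (arXiv:2305.02653), Thm. 2.1, Cor. 4.2; N. Gladkov, A. Zimin,
arXiv:2404.08873, §5; R. Ahlswede, D. E. Daykin, Z. Wahrsch. Verw. Gebiete 43 (1978) 183–185; G. Grimmett, *Percolation* (1999), §2.2.
-/

noncomputable section

namespace Summit.CriticalPhenomena.PercolationContinuityZ3.Theorems

open MeasureTheory Set Literature.Probability.LatticeModels Literature.Probability.Percolation
open scoped Classical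

namespace Consts

/-- **SK3 — the summed three-point lattice inequality = Gladkov's three-point strong Harris–Kleitman (Aas–Gladkov) inequality (typed gen 13,
PROVED gen 14; identified with the literature gen 15).**  For every finite weighted graph (`Fin n`, weights `w`, `μ = prodBernoulli w`)
and vertices `u v x`: `μ(u alone)·μ(v alone) + μ(u alone)·μ(x alone) + μ(v alone)·μ(x alone) ≤ μ(u|v|x)·μ(u ⟷ v ⟷ x)`, where "`u` alone" is the
event `u ↮ v, u ↮ x, v ⟷ x`.  This is Gladkov, Bull. LMS 56 (2024), Cor. 4.2 (= arXiv:2305.02653 Cor. 3.6; conjectured earlier by E. Aas, see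
Gladkov–Zimin arXiv:2404.08873 §5), in the tree as `Literature.Probability.Percolation.prodBernoulli_threePoint_strongHarris` (same five events,
written with two connection events each).  Typed in this programme before the identification (PAPER-2 consts track, seat prim-consts-1 gen 13,
2026-08-22; each single product and each `j_u (j_v + j_x)` is ≤ `s k` by Ahlswede–Daykin — kernel `Consts.real_alone_mul_alone_union_le`; closed
under terminal 2-sums: `Consts.TwoSum.poly_SK3`) and **PROVED independently in gen 14: `Consts.threePointSK_holds : ThreePointSK`** (`…ConstsThreePointSKProof`, with
`…ConstsThreePointSKOneEdge`): along one edge weight `t` the margin `s k − Σ j j` equals `(1−t)M(0) + tM(1) + t(1−t)·C` with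
`C = Σ_{a<b}(α_aα_b + β_aβ_b) + Σ_a α_aβ_a ≥ 0` (`α, β` the one-edge transition masses `S → J_a`, `J_a → K`), hence is concave in every edge weight;
induction on the number of weights outside `{0,1}`.  Equality holds on the path families.
builds on p205010 (kernel theorem, internal audit signed; external expert review pending).
[cite: Gladkov2024StrongFKG, Cor. 4.2 and Thm. 2.1] [cite: AhlswedeDaykin1978, Theorem 1 (the pairwise case)]
[status: proved — `Consts.threePointSK_holds`; literature: `Literature.Probability.Percolation.prodBernoulli_threePoint_strongHarris`] -/
@[conjecture] def ThreePointSK : Prop :=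
  ∀ (n : ℕ) (w : Sym2 (Fin n) → unitInterval) (u v x : Fin n),
    (prodBernoulli w).real ((openConn u v)ᶜ ∩ (openConn u x)ᶜ ∩ openConn v x) *
          (prodBernoulli w).real ((openConn v u)ᶜ ∩ (openConn v x)ᶜ ∩ openConn u x) +
        (prodBernoulli w).real ((openConn u v)ᶜ ∩ (openConn u x)ᶜ ∩ openConn v x) *
          (prodBernoulli w).real ((openConn x u)ᶜ ∩ (openConn x v)ᶜ ∩ openConn u v) +
        (prodBernoulli w).real ((openConn v u)ᶜ ∩ (openConn v x)ᶜ ∩ openConn u x) *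
          (prodBernoulli w).real ((openConn x u)ᶜ ∩ (openConn x v)ᶜ ∩ openConn u v) ≤
      (prodBernoulli w).real ((openConn u v)ᶜ ∩ (openConn u x)ᶜ ∩ (openConn v x)ᶜ) *
        (prodBernoulli w).real (openConn u v ∩ openConn u x ∩ openConn v x)

namespace TwoSum

/-- **SK3 is closed under 2-sums through a terminal** (polynomial form).  With the composite pattern law of `…ConstsTwoSumPoly` (pieces glued at the
terminal `a` and the vertex `y`; `p = (s₁, α₁, β₁, γ₁, k₁)` on `(a, b, y)`, `q = (s₂, α₂, η₂, γ₂, k₂)` on `(a, y, c)`), if both pieces satisfy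
`s·k − (sum of the three products of "alone" probabilities) ≥ 0` then so does the 2-sum: the exact identity
`SK3(2-sum) = α₁·SK3(q) + α₂·SK3(p) + (8 nonnegative monomials)` (kit j169181, 10-term certificate, checked by `linear_combination`).
[cite: AhlswedeDaykin1978, Theorem 1] -/
theorem poly_SK3 (s₁ α₁ β₁ γ₁ s₂ α₂ η₂ γ₂ : ℝ)
    (hs₁ : 0 ≤ s₁) (hα₁ : 0 ≤ α₁) (hβ₁ : 0 ≤ β₁) (hγ₁ : 0 ≤ γ₁) (hk₁ : 0 ≤ (1 - s₁ - α₁ - β₁ - γ₁))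
    (hs₂ : 0 ≤ s₂) (hα₂ : 0 ≤ α₂) (hη₂ : 0 ≤ η₂) (hγ₂ : 0 ≤ γ₂) (hk₂ : 0 ≤ (1 - s₂ - α₂ - η₂ - γ₂))
    (hS₁ : 0 ≤ s₁ * (1 - s₁ - α₁ - β₁ - γ₁) - (α₁ * β₁ + α₁ * γ₁ + β₁ * γ₁))
    (hS₂ : 0 ≤ s₂ * (1 - s₂ - α₂ - η₂ - γ₂) - (α₂ * η₂ + α₂ * γ₂ + η₂ * γ₂)) :
    0 ≤ (α₁ * s₂ + α₂ * s₁ + β₁ * γ₂ + β₁ * s₂ + γ₂ * s₁ + s₁ * s₂) * (-α₁ * α₂ - α₁ * η₂ - α₂ * γ₁ + β₁ * γ₂ + β₁ * s₂ - β₁ + γ₂ * s₁ - γ₂ + s₁ * s₂ - s₁ - s₂ + 1) -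
      ((α₁ * α₂) * (α₁ * η₂ - α₂ * s₁ - β₁ * γ₂ - β₁ * s₂ + β₁ - γ₂ * s₁ - s₁ * s₂ + s₁) + (α₁ * α₂) * (-α₁ * s₂ + α₂ * γ₁ - β₁ * γ₂ - β₁ * s₂ - γ₂ * s₁ + γ₂ - s₁ * s₂ + s₂) + (α₁ * η₂ - α₂ * s₁ - β₁ * γ₂ - β₁ * s₂ + β₁ - γ₂ * s₁ - s₁ * s₂ + s₁) * (-α₁ * s₂ + α₂ * γ₁ - β₁ * γ₂ - β₁ * s₂ - γ₂ * s₁ + γ₂ - s₁ * s₂ + s₂)) := by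
  linear_combination
    (mul_nonneg (mul_nonneg (mul_nonneg hs₁ hα₁) hα₂) hγ₂) +
    (mul_nonneg hα₁ hS₂) +
    (mul_nonneg (mul_nonneg (mul_nonneg hα₁ hβ₁) hs₂) hα₂) +
    (mul_nonneg (mul_nonneg (mul_nonneg hα₁ hβ₁) hα₂) hη₂) +
    (mul_nonneg (mul_nonneg (mul_nonneg hα₁ hβ₁) hα₂) hγ₂) +
    (mul_nonneg (mul_nonneg (mul_nonneg hα₁ hγ₁) hα₂) hη₂) +
    (mul_nonneg (mul_nonneg (mul_nonneg hα₁ hγ₁) hα₂) hγ₂) +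
    (mul_nonneg (mul_nonneg (mul_nonneg hα₁ hγ₁) hα₂) hk₂) +
    (mul_nonneg (mul_nonneg (mul_nonneg hα₁ hk₁) hα₂) hη₂) +
    (mul_nonneg hS₁ hα₂)

end TwoSum

end Consts

end Summit.CriticalPhenomena.PercolationContinuityZ3.Theorems
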